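import Summits.QuantumFields.BalabanUV.Beta.GAN24.DirichletRingEnergies
import Summits.QuantumFields.BalabanUV.Beta.GAN24.DirichletRingFlux
import Summits.QuantumFields.BalabanUV.Beta.GAN24.DirichletRingGronwall

/-!
# `BalabanUV.Beta.GAN24.DirichletRingDecay` — binder row G-an2-4 / (CONV-C), road P2 PART IV, leaf L8 of the ring lemma: THE ENERGY DECAY
# `Ẽ_a ≤ ((a+3)/(b+3))^γ·(Ẽ_b + source)`, `γ = (π/3)(1−ε/2) > 1`, AT A RE-ENTRANT VERTEX (unit b2b-balaban-gan24-p2, gen 25, v1)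

HONEST FRAMING (cell contract, verbatim): «discharging `BetaPertH` makes Bałaban's UV stability UNCONDITIONAL — a real constructive-QFT
result; it is NOT the continuum limit and NOT the Clay problem.»  This file ASSEMBLES the ring lemma of memo
`HOME/b2b-balaban-gan24-p2/gen24/W-FULL-WEIGHTED.md` §3 (step D₂, «energy decay with exponent > 1 at a 270° vertex») in MODEL COORDINATES,
lattice units: a field `U : ℤ → ℤ → ℂ` vanishing on the quadrant `{0 ≤ s} × {0 ≤ t}` with `ΔU = G` on `Q_n ∖ quadrant`, `Q_n = [−n,n)²`
(`Δ` = the 5-point Laplacian `DirichletRingEnergies.lap`; for the Dirichlet solution `u_f` of the tree this is `G = (f − a′Πu_f)/n²` read in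
the window of the vertex, the field truncated to zero on the quadrant outside the window — that transfer is leaf L14, NOT done here).
It imports BY NAME the two PART IV currencies of the same finite sums (owner ruling R-P2-g25-1, journal 2026-08-20T22:16Z):
`DirichletRingEnergies` (this lineage: `En`/`Tan`/`Rad`/`Et`/`flux`, the ring identity `Et_succ_sub` and the ℤ² GREEN IDENTITY `green_square`)
and `DirichletRingPath`/`DirichletRingFlux` (unit gan24-formalise-leaf-06: `Tring`/`Rring`/`flux`/`cRing` and the FLUX BOUND `norm_flux_le`,
leaf L5, by the sharp path Wirtinger inequality of `DirichletRingWirtinger`):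
 * §1 the JUNCTION `Tring = Tan`, `Rring = Rad`, `DirichletRingPath.flux = DirichletRingEnergies.flux` (same sums, `Σ`-order and `(i:ℤ)−k`
   vs `−k+i`), the constant `cK k = (6/π)(k+2) − 2` with **`sqrt_cRing_le : √(cRing k) ≤ cK k`** (`3.14 < π < 3.15`), hence
   `norm_flux_le_half : ‖flux_k‖ ≤ (cK_k/2)(Tan_k + Rad_k)` and the gain `2/(cK_k + 2) = π/(3(k+2))` per ring;
 * §2 `source_le` — `‖Σ_{Q_k} Ū·ΔU‖ ≤ √3·k·√E_k·√SG_k` (`SG_k = Σ_{Q_k}‖G‖²`; local Poincaré `DirichletRingPoincare.local_poincare_wedge`);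
 * §3 `ring_step` — Green + flux + source + Young: `Ẽ_{k−1} ≤ (1 − (1−ε/2)·π/(3(k+2)))·Ẽ_k + (π/(3(k+2)))·(3k²/(2ε))·SG_n`, `1 ≤ k ≤ n`;
 * §4 **`ring_energy_decay`** — for `0 < ε`, `γ := (π/3)(1−ε/2) > 1`, `a ≤ b ≤ n`:
   `Ẽ_a ≤ ((a+3)/(b+3))^γ · (Ẽ_b + (π/(2ε))·SG_n·(b+3)²/(2−γ))` by `DirichletRingGronwall.decay_of_recursion` (`A = 2`; the source is of
   critical size and is summable at the top because `γ < 2`).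
What it gives the programme: the inverse-weighted energy (B) and the weighted Hessian (A) of memo §2 near a re-entrant vertex follow from this
decay by Abel summation resp. dyadic cut-offs (leaves L9/L12, not here); with the weighted socket `DirichletBoxWeightedSockets` that is the full
rate `L⁻¹` on general unions of unit blocks in `d = 2`.

ABSOLUTE RULE (cell, verbatim): «No internally-minted statement may enter as a cited fact. Every hypothesis is either kernel-proved in
this package or a verbatim quotation of a PUBLISHED theorem with page reference. The manuscript(s) under audit are NOT citable for
their own disputed steps — they are the thing under adjudication; programme-internal (2001/route/tribunal) claims are never citable.»
[folklore] finite lattice calculus + elementary real analysis; nothing printed is a hypothesis.  NOT CLAIMED: the torus transfer (L14), the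
binders (A)/(B) (L9/L12), NE2, (CONV-C), `BetaPertH`, continuum, Clay.  «not in print; our proof attempt».  HONEST DEPENDENCY: continuum YM on
T⁴ ⇐ BetaPertH ∧ nine spine estimates (0/9 proved); BetaPertH ⇐ (D1) ∧ (D4) ∧ CAP+tail; G-an2-4 gates asym, D1 and NE2/3/4.
-/

noncomputable section

open scoped BigOperators ComplexConjugate
open Finset

namespace Summit.QuantumFields.BalabanUV.Beta.GAN24.DirichletRingDecay

open DirichletRingEnergies (hb vb EH EV En Tan Rad Et sqSum lap flux En_nonneg Tan_nonneg Rad_nonneg Et_nonneg sqSum_mono sqSum_nonneg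
  green_square Et_succ_sub)
open DirichletRingPath (Tring Rring cRing cRing_pos)
open DirichletRingPoincare (local_poincare_wedge)
open DirichletRingGronwall (decay_of_recursion)

variable (U : ℤ → ℤ → ℂ)

/-! ## §1 The junction of the two PART IV currencies and the ring constant -/

/-- junction: leaf-06's tangential ring energy is this lineage's `Tan`. [folklore] -/
theorem Tring_eq_Tan (k : ℕ) : Tring k U = Tan U k := by
  rw [Tring, Tan, ← sum_add_distrib]
  refine sum_congr rfl fun i _ => ?_
  simp only [DirichletRingPath.hb, DirichletRingPath.vb, hb, vb]
  ring_nf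

/-- junction: leaf-06's outward energy is this lineage's `Rad`. [folklore] -/
theorem Rring_eq_Rad (k : ℕ) : Rring k U = Rad U k := by
  rw [Rring, Rad, ← sum_add_distrib]
  refine sum_congr rfl fun i _ => ?_
  simp only [DirichletRingPath.hb, DirichletRingPath.vb, hb, vb]
  ring_nf

/-- junction: the two fluxes are the same sum. [folklore] -/
theorem flux_eq_flux (k : ℕ) : DirichletRingPath.flux k U = flux U k := by
  rw [DirichletRingPath.flux, flux, ← sum_add_distrib]
  refine sum_congr rfl fun i _ => ?_
  ring_nf

/-- the ring constant `cK_k := (6/π)(k+2) − 2` (so that `2/(cK_k + 2) = π/(3(k+2))`). [folklore] -/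
def cK (k : ℕ) : ℝ := 6 / Real.pi * ((k : ℝ) + 2) - 2

/-- `0 < cK_k`. [folklore] -/
theorem cK_pos (k : ℕ) : 0 < cK k := by
  rw [cK]
  have hπ := Real.pi_lt_d2
  have hπ0 := Real.pi_pos
  have hk : (0 : ℝ) ≤ k := Nat.cast_nonneg k
  have h6 : 6 / Real.pi * ((k : ℝ) + 2) ≥ 6 / Real.pi * 2 := by
    apply mul_le_mul_of_nonneg_left (by linarith) (by positivity)
  have h12 : 6 / Real.pi * 2 > 3 := by
    rw [div_mul_eq_mul_div, gt_iff_lt, lt_div_iff₀ hπ0]; nlinarith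
  linarith

/-- **the constant inequality**: `√(cRing k) ≤ cK_k` for `k ≥ 1`, i.e. `(6k−2)²/π² + 1/6 + (9k−3) ≤ ((6/π)(k+2) − 2)²`
(uses `3.14 < π < 3.15`). [folklore] -/
theorem sqrt_cRing_le {k : ℕ} (hk : 1 ≤ k) : Real.sqrt (cRing k) ≤ cK k := by
  rw [Real.sqrt_le_left (cK_pos k).le, cRing, cK]
  have hkR : (1 : ℝ) ≤ k := by exact_mod_cast hk
  set x : ℝ := 6 / Real.pi with hx
  have hπ0 := Real.pi_pos
  have hx1 : (1.9 : ℝ) ≤ x := by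
    rw [hx, le_div_iff₀ hπ0]; nlinarith [Real.pi_lt_d2]
  have hx2 : x ≤ 2 := by
    rw [hx, div_le_iff₀ hπ0]; nlinarith [Real.pi_gt_three]
  have e2 : (6 * (k : ℝ) - 2) ^ 2 / Real.pi ^ 2 = (x * k - x / 3) ^ 2 := by
    rw [hx]; field_simp; ring
  rw [e2]
  -- `(xk + 2x − 2)² − (xk − x/3)² = (7x/3 − 2)(2xk + 5x/3 − 2) ≥ 2.43·(3.8k + 1.16) ≥ 9k − 17/6`
  have hf1 : (2.43 : ℝ) ≤ 7 * x / 3 - 2 := by linarith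
  have hf2 : 3.8 * (k : ℝ) + 1.16 ≤ 2 * x * k + 5 * x / 3 - 2 := by nlinarith
  have hprod : (2.43 : ℝ) * (3.8 * (k : ℝ) + 1.16) ≤ (7 * x / 3 - 2) * (2 * x * k + 5 * x / 3 - 2) :=
    mul_le_mul hf1 hf2 (by positivity) (by linarith)
  nlinarith [hprod]

/-- **THE FLUX BOUND (L5, leaf-06's `DirichletRingFlux.norm_flux_le` by name, in this lineage's currency)**: for `k ≥ 1` and `U = 0` on the
quadrant, `‖flux_k‖ ≤ (cK_k/2)·(Tan_k + Rad_k)`. [folklore] -/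
theorem norm_flux_le_half {k : ℕ} (hk : 1 ≤ k) (hU : ∀ s t : ℤ, 0 ≤ s → 0 ≤ t → U s t = 0) :
    ‖flux U k‖ ≤ cK k / 2 * (Tan U k + Rad U k) := by
  have h := DirichletRingFlux.norm_flux_le hk hU
  rw [flux_eq_flux, Tring_eq_Tan, Rring_eq_Rad] at h
  refine h.trans (mul_le_mul_of_nonneg_right ?_ (add_nonneg (Tan_nonneg U k) (Rad_nonneg U k)))
  linarith [sqrt_cRing_le hk]

/-! ## §2 The source term -/

/-- **the source pairing**: for `1 ≤ k ≤ n`, `U = 0` on the quadrant and `ΔU = G` on `Q_n ∖ quadrant`,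
`‖Σ_{Q_k} Ū·ΔU‖ ≤ √3·k·√E_k·√SG_k`, `SG_k = Σ_{Q_k}‖G‖²` (local Poincaré `DirichletRingPoincare.local_poincare_wedge`). [folklore] -/
theorem source_le {n k : ℕ} (hk : 1 ≤ k) (hkn : k ≤ n) (G : ℤ → ℤ → ℂ)
    (hU : ∀ s t : ℤ, 0 ≤ s → 0 ≤ t → U s t = 0)
    (hEq : ∀ i j : ℤ, -(n : ℤ) ≤ i → i < n → -(n : ℤ) ≤ j → j < n → ¬(0 ≤ i ∧ 0 ≤ j) → lap U i j = G i j) :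
    ‖∑ t ∈ range (2 * k), ∑ s ∈ range (2 * k), conj (U (-(k : ℤ) + s) (-(k : ℤ) + t)) * lap U (-(k : ℤ) + s) (-(k : ℤ) + t)‖
      ≤ Real.sqrt 3 * k * Real.sqrt (En U k) * Real.sqrt (sqSum (fun i j => ‖G i j‖ ^ 2) k) := by
  -- replace `ΔU` by `G` (on the quadrant both sides vanish)
  have hpt : ∀ t ∈ range (2 * k), ∀ s ∈ range (2 * k),
      conj (U (-(k : ℤ) + s) (-(k : ℤ) + t)) * lap U (-(k : ℤ) + s) (-(k : ℤ) + t)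
        = conj (U (-(k : ℤ) + s) (-(k : ℤ) + t)) * G (-(k : ℤ) + s) (-(k : ℤ) + t) := by
    intro t ht s hs
    have ht' := mem_range.mp ht
    have hs' := mem_range.mp hs
    by_cases hq : (0 ≤ -(k : ℤ) + s ∧ 0 ≤ -(k : ℤ) + t)
    · rw [hU _ _ hq.1 hq.2, map_zero, zero_mul, zero_mul]
    · rw [hEq _ _ (by omega) (by omega) (by omega) (by omega) hq]
  rw [sum_congr rfl fun t ht => sum_congr rfl fun s hs => hpt t ht s hs]
  -- Cauchy–Schwarz (inner, then outer)
  have cs : ∀ f g : ℕ → ℝ, ∑ i ∈ range (2 * k), f i * g i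
      ≤ Real.sqrt (∑ i ∈ range (2 * k), f i ^ 2) * Real.sqrt (∑ i ∈ range (2 * k), g i ^ 2) := fun f g => by
    have h := sum_mul_sq_le_sq_mul_sq (range (2 * k)) f g
    have hf : 0 ≤ ∑ i ∈ range (2 * k), f i ^ 2 := sum_nonneg fun _ _ => sq_nonneg _
    calc ∑ i ∈ range (2 * k), f i * g i ≤ |∑ i ∈ range (2 * k), f i * g i| := le_abs_self _
      _ = Real.sqrt ((∑ i ∈ range (2 * k), f i * g i) ^ 2) := (Real.sqrt_sq_eq_abs _).symm
      _ ≤ Real.sqrt ((∑ i ∈ range (2 * k), f i ^ 2) * ∑ i ∈ range (2 * k), g i ^ 2) := Real.sqrt_le_sqrt h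
      _ = Real.sqrt (∑ i ∈ range (2 * k), f i ^ 2) * Real.sqrt (∑ i ∈ range (2 * k), g i ^ 2) := Real.sqrt_mul hf _
  set a : ℕ → ℕ → ℝ := fun t s => ‖U (-(k : ℤ) + s) (-(k : ℤ) + t)‖ with ha
  set b : ℕ → ℕ → ℝ := fun t s => ‖G (-(k : ℤ) + s) (-(k : ℤ) + t)‖ with hb'
  have hA0 : ∀ t, 0 ≤ ∑ s ∈ range (2 * k), a t s ^ 2 := fun t => sum_nonneg fun _ _ => sq_nonneg _
  have hB0 : ∀ t, 0 ≤ ∑ s ∈ range (2 * k), b t s ^ 2 := fun t => sum_nonneg fun _ _ => sq_nonneg _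
  have h1 : ‖∑ t ∈ range (2 * k), ∑ s ∈ range (2 * k), conj (U (-(k : ℤ) + s) (-(k : ℤ) + t)) * G (-(k : ℤ) + s) (-(k : ℤ) + t)‖
      ≤ ∑ t ∈ range (2 * k), Real.sqrt (∑ s ∈ range (2 * k), a t s ^ 2) * Real.sqrt (∑ s ∈ range (2 * k), b t s ^ 2) := by
    refine (norm_sum_le _ _).trans (sum_le_sum fun t _ => (norm_sum_le _ _).trans ?_)
    refine le_trans (sum_le_sum fun s _ => ?_) (cs (a t) (b t))
    rw [norm_mul, Complex.norm_conj]
  have h2 : ∑ t ∈ range (2 * k), Real.sqrt (∑ s ∈ range (2 * k), a t s ^ 2) * Real.sqrt (∑ s ∈ range (2 * k), b t s ^ 2)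
      ≤ Real.sqrt (∑ t ∈ range (2 * k), ∑ s ∈ range (2 * k), a t s ^ 2)
        * Real.sqrt (∑ t ∈ range (2 * k), ∑ s ∈ range (2 * k), b t s ^ 2) := by
    have h := cs (fun t => Real.sqrt (∑ s ∈ range (2 * k), a t s ^ 2)) (fun t => Real.sqrt (∑ s ∈ range (2 * k), b t s ^ 2))
    simp only [Real.sq_sqrt (hA0 _), Real.sq_sqrt (hB0 _)] at h
    exact h
  -- the `U`-sum is bounded by the local Poincaré inequality, the `G`-sum is `SG_k`
  have hP : ∑ t ∈ range (2 * k), ∑ s ∈ range (2 * k), a t s ^ 2 ≤ 3 * (k : ℝ) ^ 2 * En U k := by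
    have h := local_poincare_wedge hk (fun s t => U (-(k : ℤ) + s) (-(k : ℤ) + t)) (fun s t h1 _ h3 _ =>
      hU _ _ (by omega) (by omega))
    rw [sum_comm] at h
    refine h.trans (le_of_eq ?_)
    rw [En, EH, EV, sum_comm]
    simp only [hb, vb]
    push_cast
    ring_nf
  have hG : ∑ t ∈ range (2 * k), ∑ s ∈ range (2 * k), b t s ^ 2 = sqSum (fun i j => ‖G i j‖ ^ 2) k := by
    rw [sqSum]
  rw [hG] at h2
  have h3 : Real.sqrt (∑ t ∈ range (2 * k), ∑ s ∈ range (2 * k), a t s ^ 2) ≤ Real.sqrt 3 * k * Real.sqrt (En U k) := by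
    have e : Real.sqrt (3 * (k : ℝ) ^ 2 * En U k) = Real.sqrt 3 * k * Real.sqrt (En U k) := by
      rw [Real.sqrt_mul (by positivity), Real.sqrt_mul (by norm_num), Real.sqrt_sq (Nat.cast_nonneg _)]
    rw [← e]
    exact Real.sqrt_le_sqrt hP
  calc _ ≤ _ := h1
    _ ≤ _ := h2
    _ ≤ Real.sqrt 3 * k * Real.sqrt (En U k) * Real.sqrt (sqSum (fun i j => ‖G i j‖ ^ 2) k) :=
        mul_le_mul_of_nonneg_right h3 (Real.sqrt_nonneg _)

/-! ## §3 One step of the ring recursion -/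

/-- **the recursion step**: for `1 ≤ k ≤ n`, `0 < ε`, with `SG = Σ_{Q_n}‖G‖²`,
`Ẽ_{k−1} ≤ (1 − (1−ε/2)·π/(3(k+2)))·Ẽ_k + (π/(3(k+2)))·(3k²/(2ε))·SG`. [folklore] -/
theorem ring_step {n k : ℕ} (hk : 1 ≤ k) (hkn : k ≤ n) (G : ℤ → ℤ → ℂ)
    (hU : ∀ s t : ℤ, 0 ≤ s → 0 ≤ t → U s t = 0)
    (hEq : ∀ i j : ℤ, -(n : ℤ) ≤ i → i < n → -(n : ℤ) ≤ j → j < n → ¬(0 ≤ i ∧ 0 ≤ j) → lap U i j = G i j)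
    {ε : ℝ} (hε : 0 < ε) :
    Et U (k - 1) ≤ (1 - (1 - ε / 2) * (Real.pi / (3 * ((k : ℝ) + 2)))) * Et U k
      + (Real.pi / (3 * ((k : ℝ) + 2))) * (3 * (k : ℝ) ^ 2 / (2 * ε)) * sqSum (fun i j => ‖G i j‖ ^ 2) n := by
  obtain ⟨j, rfl⟩ : ∃ j, k = j + 1 := ⟨k - 1, by omega⟩
  rw [Nat.add_sub_cancel]
  set SG : ℝ := sqSum (fun i j => ‖G i j‖ ^ 2) n with hSG
  set SGk : ℝ := sqSum (fun i j => ‖G i j‖ ^ 2) (j + 1) with hSGk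
  have hSG0 : 0 ≤ SGk := sqSum_nonneg _ (fun _ _ => sq_nonneg _) _
  have hSGle : SGk ≤ SG := sqSum_mono _ (fun _ _ => sq_nonneg _) hkn
  set E : ℝ := En U (j + 1) with hE
  set T : ℝ := Tan U (j + 1) with hT
  set R : ℝ := Rad U (j + 1) with hR
  set c : ℝ := cK (j + 1) with hc
  have hE0 : 0 ≤ E := En_nonneg U _
  have hT0 : 0 ≤ T := Tan_nonneg U _
  have hR0 : 0 ≤ R := Rad_nonneg U _
  have hc0 : 0 < c := cK_pos _
  -- Green: `E = Re(source) − Re(flux) ≤ ‖source‖ + ‖flux‖`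
  have hgreen := green_square U (k := j + 1) hk
  have hsrc := source_le U hk hkn G hU hEq
  have hflux := norm_flux_le_half U hk hU
  have hEle : E ≤ Real.sqrt 3 * ((j + 1 : ℕ) : ℝ) * Real.sqrt E * Real.sqrt SGk + c / 2 * (T + R) := by
    have hre := congrArg Complex.re hgreen
    rw [Complex.add_re, Complex.ofReal_re] at hre
    have h1 := (Complex.re_le_norm _).trans hsrc
    have h2 : -(flux U (j + 1)).re ≤ ‖flux U (j + 1)‖ := by
      have := Complex.re_le_norm (-(flux U (j + 1)))
      rwa [Complex.neg_re, norm_neg] at this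
    linarith [hflux]
  -- Young: `√3 k √E √SGk ≤ (ε/2) E + 3k² SGk/(2ε)`
  have hyoung : Real.sqrt 3 * ((j + 1 : ℕ) : ℝ) * Real.sqrt E * Real.sqrt SGk
      ≤ ε / 2 * E + 3 * ((j + 1 : ℕ) : ℝ) ^ 2 / (2 * ε) * SGk := by
    set p : ℝ := Real.sqrt E with hp
    set q : ℝ := Real.sqrt 3 * ((j + 1 : ℕ) : ℝ) * Real.sqrt SGk with hq
    have hp2 : p ^ 2 = E := Real.sq_sqrt hE0
    have hq2 : q ^ 2 = 3 * ((j + 1 : ℕ) : ℝ) ^ 2 * SGk := by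
      rw [hq, mul_pow, mul_pow, Real.sq_sqrt (by norm_num), Real.sq_sqrt hSG0]
    have key : p * q ≤ ε / 2 * p ^ 2 + q ^ 2 / (2 * ε) := by
      rw [div_mul_eq_mul_div, div_add_div _ _ (two_ne_zero) (by positivity), le_div_iff₀ (by positivity)]
      nlinarith [sq_nonneg (ε * p - q), hε]
    calc Real.sqrt 3 * ((j + 1 : ℕ) : ℝ) * Real.sqrt E * Real.sqrt SGk = p * q := by rw [hp, hq]; ring
      _ ≤ ε / 2 * p ^ 2 + q ^ 2 / (2 * ε) := key
      _ = ε / 2 * E + 3 * ((j + 1 : ℕ) : ℝ) ^ 2 / (2 * ε) * SGk := by rw [hp2, hq2]; ring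
  -- the increment `Δ = Ẽ_k − Ẽ_{k−1} = T + R`
  have hΔ : Et U (j + 1) - Et U j = T + R := Et_succ_sub U j
  have hEt : Et U (j + 1) = E + R := rfl
  -- `θ = 2/(c+2) = π/(3(k+2))`
  have hθ : Real.pi / (3 * (((j + 1 : ℕ) : ℝ) + 2)) = 2 / (c + 2) := by
    rw [hc, cK]
    have hπ0 := Real.pi_pos.ne'
    field_simp
    ring
  rw [hθ]
  -- algebra: from `(1 − ε/2)(E + R) ≤ 3k²SGk/(2ε) + (c/2 + 1)(T + R)`
  have hmain : (1 - ε / 2) * (E + R) ≤ 3 * ((j + 1 : ℕ) : ℝ) ^ 2 / (2 * ε) * SGk + (c / 2 + 1) * (T + R) := by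
    nlinarith [hEle, hyoung, hR0, hT0, hε]
  have hc2 : 0 < c + 2 := by linarith
  have hEj : Et U j = E + R - (T + R) := by linarith [hΔ, hEt]
  rw [hEt, hEj]
  have hk3 : 0 ≤ 3 * ((j + 1 : ℕ) : ℝ) ^ 2 / (2 * ε) := by positivity
  have hSGk' : 3 * ((j + 1 : ℕ) : ℝ) ^ 2 / (2 * ε) * SGk ≤ 3 * ((j + 1 : ℕ) : ℝ) ^ 2 / (2 * ε) * SG :=
    mul_le_mul_of_nonneg_left hSGle hk3
  have key : (E + R - (T + R)) * (c + 2)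
      ≤ ((1 - (1 - ε / 2) * (2 / (c + 2))) * (E + R) + 2 / (c + 2) * (3 * ((j + 1 : ℕ) : ℝ) ^ 2 / (2 * ε)) * SG) * (c + 2) := by
    have e1 : ((1 - (1 - ε / 2) * (2 / (c + 2))) * (E + R) + 2 / (c + 2) * (3 * ((j + 1 : ℕ) : ℝ) ^ 2 / (2 * ε)) * SG) * (c + 2)
        = (c + 2) * (E + R) - 2 * ((1 - ε / 2) * (E + R)) + 2 * (3 * ((j + 1 : ℕ) : ℝ) ^ 2 / (2 * ε) * SG) := by
      field_simp
    rw [e1]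
    nlinarith [hmain, hSGk']
  exact le_of_mul_le_mul_right key hc2

/-! ## §4 The energy decay (L8) -/

/-- **THE RING LEMMA — ENERGY DECAY AT A RE-ENTRANT VERTEX (model coordinates, lattice units)**: let `U : ℤ → ℤ → ℂ` vanish on the
quadrant `{0 ≤ s} × {0 ≤ t}` and satisfy `ΔU = G` on `Q_n ∖ quadrant` (`Δ` the 5-point Laplacian); let `0 < ε` with `γ := (π/3)(1 − ε/2) > 1`.
Then for `a ≤ b ≤ n`, with `Ẽ_k = Et U k` (all bonds meeting `Q_k = [−k,k)²`) and `SG = Σ_{Q_n}‖G‖²`: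
`Ẽ_a ≤ ((a+3)/(b+3))^γ · (Ẽ_b + (π/(2ε))·SG·(b+3)²/(2−γ))`. [folklore] -/
theorem ring_energy_decay {n : ℕ} (G : ℤ → ℤ → ℂ)
    (hU : ∀ s t : ℤ, 0 ≤ s → 0 ≤ t → U s t = 0)
    (hEq : ∀ i j : ℤ, -(n : ℤ) ≤ i → i < n → -(n : ℤ) ≤ j → j < n → ¬(0 ≤ i ∧ 0 ≤ j) → lap U i j = G i j)
    {ε : ℝ} (hε : 0 < ε) (hγ : 1 < Real.pi / 3 * (1 - ε / 2)) {a b : ℕ} (hab : a ≤ b) (hbn : b ≤ n) :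
    Et U a ≤ ((((a : ℝ) + 3) / ((b : ℝ) + 3)) ^ (Real.pi / 3 * (1 - ε / 2)))
      * (Et U b + (Real.pi / (2 * ε) * sqSum (fun i j => ‖G i j‖ ^ 2) n) * ((b : ℝ) + 3) ^ 2 / (2 - Real.pi / 3 * (1 - ε / 2))) := by
  set γ : ℝ := Real.pi / 3 * (1 - ε / 2) with hγdef
  set SG : ℝ := sqSum (fun i j => ‖G i j‖ ^ 2) n with hSG
  have hSG0 : 0 ≤ SG := sqSum_nonneg _ (fun _ _ => sq_nonneg _) _
  have hπ3 := Real.pi_gt_three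
  have hπ4 := Real.pi_lt_four
  have hε2 : ε < 2 := by
    by_contra h
    have : Real.pi / 3 * (1 - ε / 2) ≤ 0 := by
      apply mul_nonpos_of_nonneg_of_nonpos (by positivity); linarith
    linarith
  have hγ2 : γ < 2 := by
    have : Real.pi / 3 * (1 - ε / 2) < Real.pi / 3 * 1 := by
      apply mul_lt_mul_of_pos_left (by linarith) (by positivity)
    rw [hγdef]; linarith
  -- the recursion data
  set θ : ℕ → ℝ := fun k => (1 - ε / 2) * (Real.pi / (3 * ((k : ℝ) + 2))) with hθ
  set s : ℕ → ℝ := fun k => (Real.pi / (3 * ((k : ℝ) + 2))) * (3 * (k : ℝ) ^ 2 / (2 * ε)) * SG with hs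
  set B : ℝ := Real.pi / (2 * ε) * SG with hB
  have hB0 : 0 ≤ B := by positivity
  have h := decay_of_recursion (fun k => Et U k) θ s hγ hγ2 hB0 2 hab (fun k => Et_nonneg U k)
    (fun k hak hkb => by
      have := ring_step U (k := k) (by omega) (hkb.trans hbn) G hU hEq hε
      simpa only [hθ, hs] using this)
    (fun k hak hkb => by
      rw [hθ, hγdef]; push_cast
      have hk2 : (0 : ℝ) < (k : ℝ) + 2 := by positivity
      rw [div_le_iff₀ hk2]
      have : Real.pi / (3 * ((k : ℝ) + 2)) * ((k : ℝ) + 2) = Real.pi / 3 := by field_simp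
      nlinarith [this])
    (fun k hak hkb => by
      rw [hθ]
      have hk2 : (3 : ℝ) ≤ (k : ℝ) + 2 := by
        have : (1 : ℝ) ≤ k := by exact_mod_cast Nat.succ_le_of_lt (lt_of_le_of_lt (Nat.zero_le a) hak)
        linarith
      have h1 : Real.pi / (3 * ((k : ℝ) + 2)) ≤ Real.pi / (3 * 3) :=
        div_le_div_of_nonneg_left Real.pi_pos.le (by norm_num) (by nlinarith)
      have h2 : 0 < 1 - ε / 2 := by linarith
      have h3 : (1 - ε / 2) ≤ 1 := by linarith
      calc (1 - ε / 2) * (Real.pi / (3 * ((k : ℝ) + 2))) ≤ 1 * (Real.pi / (3 * 3)) :=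
            mul_le_mul h3 h1 (by positivity) zero_le_one
        _ ≤ 1 := by nlinarith)
    (fun k hak hkb => by
      rw [hs, hB]; push_cast
      have hk0 : (0 : ℝ) ≤ k := Nat.cast_nonneg k
      have hk2 : (0 : ℝ) < (k : ℝ) + 2 := by positivity
      -- `π/(3(k+2)) · 3k²/(2ε) · SG ≤ π/(2ε) · SG · (k+2)` since `k² ≤ (k+2)²`
      rw [show Real.pi / (3 * ((k : ℝ) + 2)) * (3 * (k : ℝ) ^ 2 / (2 * ε)) * SG
          = Real.pi / (2 * ε) * SG * ((k : ℝ) ^ 2 / ((k : ℝ) + 2)) by field_simp]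
      refine mul_le_mul_of_nonneg_left ?_ hB0
      rw [div_le_iff₀ hk2]; nlinarith)
  -- unpack
  have e3 : ∀ m : ℕ, (m : ℝ) + 1 + ((2 : ℕ) : ℝ) = (m : ℝ) + 3 := fun m => by push_cast; ring
  simp only [e3] at h
  rw [hB] at h
  convert h using 3

end Summit.QuantumFields.BalabanUV.Beta.GAN24.DirichletRingDecay

end
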